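import Summits.Ventures.PercRepro.ProfileGapMonoThresholdSelfPay

/-!
# PercRepro — PART A IN INTEGER FORM: the dependent deficient sets are paid by the dependent targets (p5, gen 31;
`proofs/P5-GM1.md` §43(c), Part A)

At the top threshold of co-rank `4` on a matroid of rank `ρ(E) ≥ 4`, a DEPENDENT deficient set — a demanding `B`
(rank `3`, spanning complement) whose plane has `ν + 1` points and which has at most two coloops — owns the `ρ(E) − 1`
targets `B ∪ y`, `y ∉ cl B`, each a dependent target (`κ(B ∪ y) = κ(B) + 1 ≤ 3`) with slack `4 − d(B ∪ y) ≥ 1`, and a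
dependent target `S` is `B ∪ y` for at most `d(S) ≤ 3` such pairs.  Hence `3·#𝔇 ≤ (ρ(E) − 1)·#𝔇 = #{(B, y)}
≤ Σ d(S) ≤ 3·#(image) ≤ 3·Σ_{dependent S} (4 − d(S))`: **`card_dependent_deficient_le`**.  The dependent targets are
disjoint from the independent units that pay the independent deficient sets (NullityThree at nullity `3`).  Nothing
open is asserted.
-/

open scoped Matroid

namespace PercRepro.Cogirth

open Finset ThmH Skew Shadow Profile

variable {α : Type} [DecidableEq α] {N : Matroid α} [N.Finite]

/-- **PART A**: on a matroid of rank `ρ(E) ≥ 4`, the number of dependent deficient sets (demanding `B ∈ Rq N 3`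
with `#cl B + ρ(E) = #E + 1` and `#coloops(B) ≤ 2`) is at most the total slack `Σ (4 − d(S))` of the dependent
targets (`S ∈ levelSetCoQ N (ρ(E) − 1) 4` with `#coloops(S) ≤ 3`), where
`d(S) = #{y ∈ coloops(S) : S ∖ y demanding}`. -/
theorem card_dependent_deficient_le (hR : 4 ≤ rk N (gr N)) :
    ((Rq N 3).filter (fun B => rk N (gr N) - 1 + 1 ≤ rk N (gr N \ B) ∧
        (clF N B).card + rk N (gr N) = (gr N).card + 1 ∧ (coloops N B).card ≤ 2)).card ≤
      ∑ S ∈ (levelSetCoQ N (rk N (gr N) - 1) 4).filter (fun S => (coloops N S).card ≤ 3),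
        (4 - ((coloops N S).filter
          (fun y => S.erase y ∈ (Rq N 3).filter (fun B => rk N (gr N) - 1 + 1 ≤ rk N (gr N \ B)))).card) := by
  set R := rk N (gr N) with hRdef
  set 𝔇 := (Rq N 3).filter (fun B => R - 1 + 1 ≤ rk N (gr N \ B) ∧
    (clF N B).card + R = (gr N).card + 1 ∧ (coloops N B).card ≤ 2) with h𝔇def
  set Lf := (Rq N 3).filter (fun B => R - 1 + 1 ≤ rk N (gr N \ B)) with hLfdef
  set Td := (levelSetCoQ N (R - 1) 4).filter (fun S => (coloops N S).card ≤ 3) with hTddef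
  -- the pairs (B, y)
  set Q := 𝔇.sigma (fun B => gr N \ clF N B) with hQdef
  let g : (Σ _ : Finset α, α) → Finset α := fun x => insert x.2 x.1
  have hdef : ∀ B ∈ 𝔇, B ∈ Rq N 3 ∧ rk N (gr N \ B) = R ∧ (clF N B).card + R = (gr N).card + 1 ∧
      (coloops N B).card ≤ 2 := by
    intro B hB
    obtain ⟨hBq, hBt, hcl, hκ⟩ := mem_filter.1 hB
    have := rk_mono' (M := N) (sdiff_subset : gr N \ B ⊆ gr N)
    exact ⟨hBq, by omega, hcl, hκ⟩
  -- (1) #Q = (R − 1) · #𝔇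
  have hQcard : Q.card = (R - 1) * 𝔇.card := by
    rw [hQdef, card_sigma]
    have : ∀ B ∈ 𝔇, (gr N \ clF N B).card = R - 1 := by
      intro B hB
      obtain ⟨_, _, hcl, _⟩ := hdef B hB
      have := card_sdiff_add_card_eq_card (clF_subset_gr (M := N) B)
      omega
    rw [sum_congr rfl this, sum_const, smul_eq_mul, mul_comm]
  -- (2) g maps Q into the dependent targets, and the fibre over S injects into the demanding coloops of S
  have hgmem : ∀ x ∈ Q, g x ∈ Td := by
    rintro ⟨B, y⟩ hx
    obtain ⟨hB, hy⟩ := mem_sigma.1 hx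
    simp only at hy
    obtain ⟨hBq, hBsp, _, hκ⟩ := hdef B hB
    have hBg : B ⊆ gr N := (mem_Rq.1 hBq).1
    have hyg : y ∈ gr N := (mem_sdiff.1 hy).1
    have hycl : y ∉ clF N B := (mem_sdiff.1 hy).2
    refine mem_filter.2 ⟨insert_mem_levelSetCoQ_top_of_spanning (q := 4) (by norm_num) hBq hBsp hy, ?_⟩
    show (coloops N (insert y B)).card ≤ 3
    rw [card_coloops_insert_of_notMem_clF hBg hyg hycl]
    omega
  have hfib : ∀ S ∈ Q.image g, (Q.filter (fun x => g x = S)).card ≤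
      ((coloops N S).filter (fun y => S.erase y ∈ Lf)).card := by
    intro S _
    refine card_le_card_of_injOn (fun x => x.2) ?_ ?_
    · rintro ⟨B, y⟩ hx
      obtain ⟨hxQ, hgx⟩ := mem_filter.1 hx
      simp only [g] at hgx
      obtain ⟨hB, hy⟩ := mem_sigma.1 hxQ
      simp only at hy
      obtain ⟨hBq, hBsp, _, _⟩ := hdef B hB
      have hBg : B ⊆ gr N := (mem_Rq.1 hBq).1
      have hyg : y ∈ gr N := (mem_sdiff.1 hy).1
      have hycl : y ∉ clF N B := (mem_sdiff.1 hy).2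
      have hyB : y ∉ B := fun h => hycl (subset_clF hBg h)
      refine mem_filter.2 ⟨?_, ?_⟩
      · rw [← hgx, coloops_insert_of_notMem_clF hBg hyg hycl]
        exact mem_insert_self y _
      · rw [← hgx, erase_insert hyB]
        exact mem_filter.2 ⟨hBq, by omega⟩
    · rintro ⟨B₁, y₁⟩ hx₁ ⟨B₂, y₂⟩ hx₂ heq
      simp only at heq
      subst heq
      obtain ⟨hxQ₁, hgx₁⟩ := mem_filter.1 hx₁
      obtain ⟨hxQ₂, hgx₂⟩ := mem_filter.1 hx₂
      simp only [g] at hgx₁ hgx₂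
      have hy₁ : y₁ ∉ B₁ := by
        obtain ⟨hB, hy⟩ := mem_sigma.1 hxQ₁
        simp only at hy
        exact fun h => (mem_sdiff.1 hy).2 (subset_clF (mem_Rq.1 (hdef B₁ hB).1).1 h)
      have hy₂ : y₁ ∉ B₂ := by
        obtain ⟨hB, hy⟩ := mem_sigma.1 hxQ₂
        simp only at hy
        exact fun h => (mem_sdiff.1 hy).2 (subset_clF (mem_Rq.1 (hdef B₂ hB).1).1 h)
      have : B₁ = B₂ := by
        have h : (insert y₁ B₁).erase y₁ = (insert y₁ B₂).erase y₁ := by rw [hgx₁, hgx₂]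
        rwa [erase_insert hy₁, erase_insert hy₂] at h
      rw [this]
  -- (3) the counting
  have hQle : Q.card ≤ ∑ S ∈ Q.image g, ((coloops N S).filter (fun y => S.erase y ∈ Lf)).card := by
    rw [card_eq_sum_card_image g Q]
    exact sum_le_sum hfib
  have himg : Q.image g ⊆ Td := image_subset_iff.2 hgmem
  have hd3 : ∀ S ∈ Td, ((coloops N S).filter (fun y => S.erase y ∈ Lf)).card ≤ 3 := by
    intro S hS
    exact (card_filter_le _ _).trans (mem_filter.1 hS).2
  have hsum3 : ∑ S ∈ Q.image g, ((coloops N S).filter (fun y => S.erase y ∈ Lf)).card ≤ 3 * (Q.image g).card := by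
    calc ∑ S ∈ Q.image g, ((coloops N S).filter (fun y => S.erase y ∈ Lf)).card
        ≤ ∑ _S ∈ Q.image g, 3 := sum_le_sum (fun S hS => hd3 S (himg hS))
      _ = 3 * (Q.image g).card := by rw [sum_const, smul_eq_mul, mul_comm]
  have hslack : (Q.image g).card ≤ ∑ S ∈ Td, (4 - ((coloops N S).filter (fun y => S.erase y ∈ Lf)).card) := by
    calc (Q.image g).card = ∑ _S ∈ Q.image g, 1 := card_eq_sum_ones _
      _ ≤ ∑ S ∈ Q.image g, (4 - ((coloops N S).filter (fun y => S.erase y ∈ Lf)).card) :=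
          sum_le_sum (fun S hS => by have := hd3 S (himg hS); omega)
      _ ≤ ∑ S ∈ Td, (4 - ((coloops N S).filter (fun y => S.erase y ∈ Lf)).card) :=
          sum_le_sum_of_subset_of_nonneg himg (fun _ _ _ => Nat.zero_le _)
  have h3 : 3 * 𝔇.card ≤ (R - 1) * 𝔇.card := Nat.mul_le_mul_right _ (by omega)
  have := hQcard ▸ hQle
  omega

end PercRepro.Cogirth
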